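import Literature.MathematicalPhysics.QuantumLattice.HubbardWave0RayleighProofs
import Literature.MathematicalPhysics.QuantumLattice.FermionQuasiFree
import HarnessLib

/-!
# One-body eigenmodes and the Pauli lower bound for `dΓ(h)` (band-bottom analysis, part 1)

Topic `Literature/MathematicalPhysics/QuantumLattice` (sub-namespace `HubbardBandBottom`). Written for
route `HubbardSuperconductivity/ParityLeeYang`, support `BandBottomOnAxis` (stmt-HubbardSuperconductivity-8386).

Generic second-quantisation bookkeeping on the tree's Jordan–Wigner Fock space
`Fock ι = Finset ι → ℂ`, for a one-body matrix `h` with a complete family of eigenmodes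
`u : κ → (ι → ℂ)`, `h u_k = e_k u_k`, `Σ_k u_k(i) conj (u_k(j)) = δ_ij`:

* `dGamma_eq_sum_smul_numberMode` — `dΓ(h) = Σ_k e_k n(u_k)` (`n(f) = c†(f) c(f)`);
* `re_rayleigh_dGamma_eq_sum` — `Re ⟨ψ, dΓ(h) ψ⟩ = Σ_k e_k ‖c(u_k) ψ‖²`;
* `normSq_annihilate_mulVec_le` — the Pauli principle `‖c(f) ψ‖² ≤ ‖ψ‖²` for a unit mode `f`;
* `pauli_lower_bound` — if every `e_k ≥ E` and `e_k ≥ E + γ` off a finite set `S` of modes, then on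
  the `N`-particle sector `Re ⟨ψ, dΓ(h) ψ⟩ ≥ (N E + γ (N - |S|)) ‖ψ‖²`
  (at most `|S|` particles fit into the modes of `S`);
* `annihilate_mulVec_eq_zero_of_rayleigh_le` — the equality case: a state of energy `≤ N E` is
  annihilated by every `c(u_k)`, `k ∉ S`, when the modes off `S` lie strictly above `E`.

Everything is proved from the tree's `RayleighBound` API (`annihilate`, `create`, `numberMode`,
`normSq`, `annihilate_mul_create_add`, `IsNParticle.sum_normSq_annihilate_mulVec`); no
definitions. Source: the Pauli principle / second quantisation, Bratteli–Robinson II §5.2.1–5.2.2.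
-/

namespace Literature.MathematicalPhysics.QuantumLattice.HubbardBandBottom

open Matrix Finset Literature.MathematicalPhysics.QuantumLattice
  Literature.MathematicalPhysics.QuantumLattice.RayleighBound

variable {ι : Type*} [LinearOrder ι] [Fintype ι] {κ : Type*} [Fintype κ]

/-- `⟨ψ, n(f) ψ⟩ = ‖c(f) ψ‖²`. [folklore] -/
theorem star_dotProduct_numberMode_mulVec (f : ι → ℂ) (ψ : Fock ι) :
    star ψ ⬝ᵥ (numberMode f *ᵥ ψ) = ((normSq (annihilate f *ᵥ ψ) : ℝ) : ℂ) := by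
  rw [← star_dotProduct_self_eq_normSq, star_mulVec_dotProduct, annihilate_conjTranspose,
    mulVec_mulVec, numberMode]

/-- `⟨ψ, c(f) c†(f) ψ⟩ = ‖c†(f) ψ‖²`. [folklore] -/
theorem star_dotProduct_annihilate_create_mulVec (f : ι → ℂ) (ψ : Fock ι) :
    star ψ ⬝ᵥ ((annihilate f * create f) *ᵥ ψ) = ((normSq (create f *ᵥ ψ) : ℝ) : ℂ) := by
  rw [← star_dotProduct_self_eq_normSq, star_mulVec_dotProduct, create_conjTranspose,
    mulVec_mulVec]

/-- **The Pauli principle for one mode**: `‖c(f) ψ‖² ≤ ‖ψ‖²` for a unit one-particle function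
`f` (`c(f)c†(f) + c†(f)c(f) = 1` and `c(f)c†(f) ≥ 0`). [folklore] -/
theorem normSq_annihilate_mulVec_le {f : ι → ℂ} (hf : star f ⬝ᵥ f = 1) (ψ : Fock ι) :
    normSq (annihilate f *ᵥ ψ) ≤ normSq ψ := by
  have h := annihilate_mul_create_add f f
  rw [hf, one_smul] at h
  have key : ((normSq (create f *ᵥ ψ) : ℝ) : ℂ) + ((normSq (annihilate f *ᵥ ψ) : ℝ) : ℂ) =
      ((normSq ψ : ℝ) : ℂ) := by
    rw [← star_dotProduct_annihilate_create_mulVec, ← star_dotProduct_numberMode_mulVec,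
      numberMode, ← dotProduct_add, ← add_mulVec, h, one_mulVec, star_dotProduct_self_eq_normSq]
  have key' : normSq (create f *ᵥ ψ) + normSq (annihilate f *ᵥ ψ) = normSq ψ := by
    exact_mod_cast key
  linarith [normSq_nonneg (create f *ᵥ ψ)]

/-- Entrywise spectral expansion `h_ij = Σ_k e_k u_k(i) conj (u_k(j))` of a one-body matrix along a
complete family of eigenmodes. [folklore] -/
theorem apply_eq_sum_eigenmodes (h : Matrix ι ι ℂ) (u : κ → ι → ℂ) (e : κ → ℝ)
    (hu : ∀ i j : ι, ∑ k, u k i * star (u k j) = if i = j then 1 else 0)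
    (heig : ∀ k, h *ᵥ u k = ((e k : ℝ) : ℂ) • u k) (i j : ι) :
    h i j = ∑ k, (e k : ℂ) * (u k i * star (u k j)) := by
  calc h i j = ∑ l, h i l * (if l = j then 1 else 0) := by
        rw [Finset.sum_eq_single j (fun l _ hl => by rw [if_neg hl, mul_zero])
          (fun hj => absurd (Finset.mem_univ j) hj), if_pos rfl, mul_one]
    _ = ∑ l, h i l * ∑ k, u k l * star (u k j) := by simp_rw [hu]
    _ = ∑ l, ∑ k, h i l * (u k l * star (u k j)) := by simp_rw [Finset.mul_sum]
    _ = ∑ k, ∑ l, h i l * (u k l * star (u k j)) := Finset.sum_comm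
    _ = ∑ k, (∑ l, h i l * u k l) * star (u k j) := by
        simp_rw [Finset.sum_mul, mul_assoc]
    _ = ∑ k, (e k : ℂ) * (u k i * star (u k j)) := by
        refine Finset.sum_congr rfl fun k _ => ?_
        have hk := congrFun (heig k) i
        simp only [mulVec, dotProduct, Pi.smul_apply, smul_eq_mul] at hk
        rw [hk, mul_assoc]

/-- **Spectral expansion of the second quantisation**: `dΓ(h) = Σ_k e_k n(u_k)` for a complete
family of eigenmodes `u_k` of `h`. Bratteli–Robinson II §5.2.1. [folklore] -/
theorem dGamma_eq_sum_smul_numberMode (h : Matrix ι ι ℂ) (u : κ → ι → ℂ) (e : κ → ℝ)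
    (hu : ∀ i j : ι, ∑ k, u k i * star (u k j) = if i = j then 1 else 0)
    (heig : ∀ k, h *ᵥ u k = ((e k : ℝ) : ℂ) • u k) :
    dGamma h = ∑ k, (e k : ℂ) • numberMode (u k) := by
  have h1 : ∀ k, numberMode (u k) =
      ∑ i, ∑ j, (u k i * star (u k j)) • (creation i * annihilation j) := fun k => by
    simp only [numberMode, annihilate, create, Finset.sum_mul_sum, smul_mul_smul_comm]
  simp_rw [h1, Finset.smul_sum, smul_smul]
  rw [dGamma_eq]
  symm
  calc ∑ k, ∑ i, ∑ j, ((e k : ℂ) * (u k i * star (u k j))) • (creation i * annihilation j)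
      = ∑ i, ∑ k, ∑ j, ((e k : ℂ) * (u k i * star (u k j))) • (creation i * annihilation j) :=
        Finset.sum_comm
    _ = ∑ i, ∑ j, ∑ k, ((e k : ℂ) * (u k i * star (u k j))) • (creation i * annihilation j) :=
        Finset.sum_congr rfl fun i _ => Finset.sum_comm
    _ = ∑ i, ∑ j, h i j • (creation i * annihilation j) := by
        refine Finset.sum_congr rfl fun i _ => Finset.sum_congr rfl fun j _ => ?_
        rw [← Finset.sum_smul, apply_eq_sum_eigenmodes h u e hu heig i j]

/-- **`Re ⟨ψ, dΓ(h) ψ⟩ = Σ_k e_k ‖c(u_k) ψ‖²`** along a complete family of eigenmodes. [folklore] -/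
theorem re_rayleigh_dGamma_eq_sum (h : Matrix ι ι ℂ) (u : κ → ι → ℂ) (e : κ → ℝ)
    (hu : ∀ i j : ι, ∑ k, u k i * star (u k j) = if i = j then 1 else 0)
    (heig : ∀ k, h *ᵥ u k = ((e k : ℝ) : ℂ) • u k) (ψ : Fock ι) :
    (star ψ ⬝ᵥ (dGamma h *ᵥ ψ)).re = ∑ k, e k * normSq (annihilate (u k) *ᵥ ψ) := by
  rw [dGamma_eq_sum_smul_numberMode h u e hu heig, Matrix.sum_mulVec, dotProduct_sum,
    Complex.re_sum]
  refine Finset.sum_congr rfl fun k _ => ?_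
  rw [Matrix.smul_mulVec, dotProduct_smul, star_dotProduct_numberMode_mulVec, smul_eq_mul,
    ← Complex.ofReal_mul, Complex.ofReal_re]

/-- **Pauli lower bound.** If every mode energy is `≥ E`, and `≥ E + γ` (`γ ≥ 0`) outside a finite
set `S` of unit modes, then on the `N`-particle sector
`Re ⟨ψ, dΓ(h) ψ⟩ ≥ (N E + γ (N - |S|)) ‖ψ‖²`: at most `|S|` fermions occupy the modes of `S`.
[folklore] -/
theorem pauli_lower_bound (h : Matrix ι ι ℂ) (u : κ → ι → ℂ) (e : κ → ℝ)
    (hu : ∀ i j : ι, ∑ k, u k i * star (u k j) = if i = j then 1 else 0)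
    (hon : ∀ k, star (u k) ⬝ᵥ u k = 1)
    (heig : ∀ k, h *ᵥ u k = ((e k : ℝ) : ℂ) • u k) {E γ : ℝ} (hγ : 0 ≤ γ) (S : Finset κ)
    (hE : ∀ k, E ≤ e k) (hS : ∀ k, k ∉ S → E + γ ≤ e k) {N : ℕ} {ψ : Fock ι}
    (hψ : IsNParticle N ψ) :
    ((N : ℝ) * E + γ * ((N : ℝ) - S.card)) * normSq ψ ≤ (star ψ ⬝ᵥ (dGamma h *ᵥ ψ)).re := by
  classical
  set w : κ → ℝ := fun k => normSq (annihilate (u k) *ᵥ ψ) with hw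
  have hw0 : ∀ k, 0 ≤ w k := fun k => normSq_nonneg _
  have hw1 : ∀ k, w k ≤ normSq ψ := fun k => normSq_annihilate_mulVec_le (hon k) ψ
  have hsum : ∑ k, w k = N * normSq ψ := hψ.sum_normSq_annihilate_mulVec u hu
  rw [re_rayleigh_dGamma_eq_sum h u e hu heig ψ]
  -- split the mode sum into `S` and its complement
  have hsplit : ∀ f : κ → ℝ, ∑ k, f k = ∑ k ∈ S, f k + ∑ k ∈ Sᶜ, f k := fun f =>
    (Finset.sum_add_sum_compl S f).symm
  have hlow : ∑ k, (E + γ * (if k ∈ S then 0 else 1)) * w k ≤ ∑ k, e k * w k := by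
    refine Finset.sum_le_sum fun k _ => mul_le_mul_of_nonneg_right ?_ (hw0 k)
    by_cases hk : k ∈ S
    · rw [if_pos hk, mul_zero, add_zero]; exact hE k
    · rw [if_neg hk, mul_one]; exact hS k hk
  have hexp : ∑ k, (E + γ * (if k ∈ S then 0 else 1)) * w k =
      E * ∑ k, w k + γ * ∑ k ∈ Sᶜ, w k := by
    simp_rw [add_mul, Finset.sum_add_distrib, ← Finset.mul_sum, mul_assoc, ← Finset.mul_sum]
    congr 1
    rw [hsplit]
    rw [Finset.sum_eq_zero (fun k hk => by rw [if_pos hk, zero_mul]), zero_add]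
    congr 1
    exact Finset.sum_congr rfl fun k hk => by rw [if_neg (Finset.mem_compl.1 hk), one_mul]
  have hcompl : ∑ k ∈ Sᶜ, w k = N * normSq ψ - ∑ k ∈ S, w k := by
    rw [← hsum, hsplit w]; ring
  have hSle : ∑ k ∈ S, w k ≤ S.card * normSq ψ := by
    calc ∑ k ∈ S, w k ≤ ∑ _k ∈ S, normSq ψ := Finset.sum_le_sum fun k _ => hw1 k
      _ = S.card * normSq ψ := by rw [Finset.sum_const, nsmul_eq_mul]
  calc ((N : ℝ) * E + γ * ((N : ℝ) - S.card)) * normSq ψ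
      = E * (N * normSq ψ) + γ * (N * normSq ψ - S.card * normSq ψ) := by ring
    _ ≤ E * (N * normSq ψ) + γ * (N * normSq ψ - ∑ k ∈ S, w k) := by
        gcongr
    _ = ∑ k, (E + γ * (if k ∈ S then 0 else 1)) * w k := by rw [hexp, hcompl, hsum]
    _ ≤ ∑ k, e k * w k := hlow

omit [LinearOrder ι] in
/-- `normSq φ = 0` forces `φ = 0`. [folklore] -/
theorem eq_zero_of_normSq_eq_zero {φ : Fock ι} (h : normSq φ = 0) : φ = 0 := by
  have h' : ∀ s ∈ (Finset.univ : Finset (Finset ι)), ‖φ s‖ ^ 2 = 0 :=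
    (Finset.sum_eq_zero_iff_of_nonneg fun s _ => by positivity).1 h
  funext s
  have := h' s (Finset.mem_univ s)
  rwa [sq_eq_zero_iff, norm_eq_zero] at this

/-- **Equality case of the Pauli bound.** If every mode energy is `≥ E` and is `> E` outside `S`,
an `N`-particle vector of energy `Re ⟨ψ, dΓ(h) ψ⟩ ≤ N E ‖ψ‖²` is annihilated by every `c(u_k)`,
`k ∉ S` (all its particles sit in the modes of `S`). [folklore] -/
theorem annihilate_mulVec_eq_zero_of_rayleigh_le (h : Matrix ι ι ℂ) (u : κ → ι → ℂ) (e : κ → ℝ)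
    (hu : ∀ i j : ι, ∑ k, u k i * star (u k j) = if i = j then 1 else 0)
    (heig : ∀ k, h *ᵥ u k = ((e k : ℝ) : ℂ) • u k) {E : ℝ} (S : Finset κ)
    (hE : ∀ k, E ≤ e k) (hS : ∀ k, k ∉ S → E < e k) {N : ℕ} {ψ : Fock ι}
    (hψ : IsNParticle N ψ) (hle : (star ψ ⬝ᵥ (dGamma h *ᵥ ψ)).re ≤ N * E * normSq ψ)
    {k : κ} (hk : k ∉ S) : annihilate (u k) *ᵥ ψ = 0 := by
  classical
  set w : κ → ℝ := fun k => normSq (annihilate (u k) *ᵥ ψ) with hw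
  have hw0 : ∀ k, 0 ≤ w k := fun k => normSq_nonneg _
  have hsum : ∑ k, w k = N * normSq ψ := hψ.sum_normSq_annihilate_mulVec u hu
  rw [re_rayleigh_dGamma_eq_sum h u e hu heig ψ] at hle
  -- `Σ_k (e_k - E) w_k ≤ 0` with nonnegative terms
  have hle' : ∑ k, (e k - E) * w k ≤ 0 := by
    have : ∑ k, (e k - E) * w k = ∑ k, e k * w k - E * ∑ k, w k := by
      simp_rw [sub_mul, Finset.sum_sub_distrib, ← Finset.mul_sum]
    rw [this, hsum]; linarith
  have hterm : ∀ k, 0 ≤ (e k - E) * w k := fun k => mul_nonneg (sub_nonneg.2 (hE k)) (hw0 k)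
  have hzero := (Finset.sum_eq_zero_iff_of_nonneg fun k _ => hterm k).1
    (le_antisymm hle' (Finset.sum_nonneg fun k _ => hterm k)) k (Finset.mem_univ k)
  have hwk : w k = 0 := by
    rcases mul_eq_zero.1 hzero with h1 | h1
    · exact absurd (sub_eq_zero.1 h1) (ne_of_gt (hS k hk))
    · exact h1
  exact eq_zero_of_normSq_eq_zero hwk

end Literature.MathematicalPhysics.QuantumLattice.HubbardBandBottom
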